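import Summits.QuantumFields.GaugeBoot.StrongCouplingPlaquetteSUNPieces
import Summits.QuantumFields.GaugeBoot.StrongCouplingPlaquetteUN
import HarnessLib

/-!
# Strong coupling from the loop equation, V: the `SU(N)` plaquette through second order, `⟨ū_P⟩ = β_std/(2N²) + O(β_std²)` explicitly, `N ≥ 3` (gauge-boot, ADDENDUM 22 part E, file 2/2)

HONEST FRAMING (cell `pub-gaugeboot`, page 1 of every file): the venture produces certified bounds
on lattice expectations at stated coupling, gauge group, dimension and torus size; NOT a mass gap,
NOT a continuum limit, NOT a string tension; NOT Yang–Mills-summit-bearing (barriers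
`FixedCouplingUltralocality`, `PerturbativeInvisibility`).  An analytic STRONG-COUPLING statement with explicit,
volume-independent (crude) constants, valid for every torus side `L ≥ 2` and every real coupling; it is informative only
for `β_std ≲ 10⁻²` and certifies no number of CERTIFIED.md (whose couplings are `β_std ≥ 1`).

## Content (`SU(N)`, `N ≥ 3`, fundamental representation, torus `(ℤ/L)^d`, `d ≥ 2`, `L ≥ 2`)

Two loop-equation steps (Makeenko's iteration at finite `N`, closed by `|tr| ≤ N`).  With tree coupling `β = β_std/N`
the plaquette equation reads `(N − 1/N)E[tr U_P] = (β/2)((N − 1/N) − b') − (β/2)Σ'g`, where the primed sum runs over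
the `2d − 3` plaquettes through the edge other than `P̃₀` (each `g` a difference of two deformed single traces and two
double traces, all `O(β)` by `StrongCouplingPlaquetteSUNPieces`) and
`b' = E[tr U_P²] − E[(tr U_P)²]/N + (E|tr U_P|² − 1)/N = O(β)` (ibid.).  Result:

* ★★★ `abs_wilsonExpectation_meanPlaquette_sub_suN_le` — for `N ≥ 3`, `d ≥ 2`, EVERY `L ≥ 2`, EVERY real tree coupling `β`:
  **`|⟨ū_P⟩_{β,L} − β/(2N)| ≤ (2(d−1)β²/(N²−1))·(1 + 4N⁴/((N²−1)(N²−4)) + 4(2d−3)N²/(N²−1))`**;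
* ★★★ `abs_plaquetteExpectation_sub_le` — the cell's form: **`|plaquetteExpectation N D L β_std − β_std/(2N²)| ≤ C(N,D)·β_std²`**,
  `C(N,D) = (2(D−1)/(N²(N²−1)))·(1 + 4N⁴/((N²−1)(N²−4)) + 4(2D−3)N²/(N²−1))`; rows WITH NUMBERS: `T4` (`SU(3)`, `D = 4`)
  `|plaquetteExpectation 3 4 L β − β/18| ≤ 79β²/30`, `T3` (`SU(3)`, `D = 3`) `|… − β/18| ≤ 113β²/90` — the first
  strong-coupling coefficient `1/(2N²) = 1/18` of the `SU(3)` plaquette with an explicit, volume-uniform remainder, for every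
  torus.  `SU(2)` (`⟨ū_P⟩ = β_std/4 + O(β²)`: the doubly-wound plaquette is not small there) is the sibling file
  `StrongCouplingPlaquetteSU2`.

References: Yu. Makeenko, *Methods of contemporary gauge theory* (2002), Problem 12.7; M. Creutz, *Quarks, gluons and
lattices* (1983) Ch. 10; R. Balian, J.-M. Drouffe, C. Itzykson, Phys. Rev. D 11 (1975) 2104 (strong-coupling series);
P. Anderson, M. Kruczenski, Nucl. Phys. B 921 (2017) §2.  Everything is `[folklore]`.
-/

noncomputable section

open MeasureTheory Filter Topology NormedSpace
open scoped Matrix.Norms.Frobenius Matrix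
open Literature.MathematicalPhysics.QuantumFieldTheory Literature.MathematicalPhysics.QuantumLattice
open Summit.QuantumFields.YangMills.Cruxes.CurvatureAmnesia.WardDefect.SchwingerDyson

namespace Summit.QuantumFields.GaugeBoot

namespace StrongCoupling

variable {d L N : ℕ} [NeZero L]

/-- **The primed terms are `O(β)`** (`SU(N)`, `N ≥ 2`): for `q` read from `x`, closed at `x`, with `q` and `q⁻¹` avoiding
`(x + e_μ, ν₀)`, the plaquette-term combination
`g = E[tr hol(P̃₀q)] − E[tr hol(P̃₀q⁻¹)] − (1/N)(E[tr U_P tr hol q] − E[tr U_P tr hol q⁻¹])` has `‖g‖ ≤ 16(d−1)N²|β|/(N²−1)`.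
[folklore] -/
theorem norm_plaqTermIntegral_suN_le (hN : 2 ≤ N) (hL : (1 : ZMod L) ≠ 0) (β : ℝ) (x : Site d L) {μ ν₀ : Fin d}
    (hμν₀ : μ ≠ ν₀) {q : Word d} (hq : Word.Avoids x q (x.shift μ, ν₀)) (hq' : Word.Avoids x q.reverse (x.shift μ, ν₀))
    (hqx : Word.endpoint x q = x) :
    ‖(∫ U, (fundamentalRep (Fin N) (wordHolonomy U x (plaqWord μ ν₀ true ++ q))).trace
        ∂(wilsonMeasure (d := d) (L := L) (fundamentalRep (Fin N)) β)) -
      (∫ U, (fundamentalRep (Fin N) (wordHolonomy U x (plaqWord μ ν₀ true ++ q.reverse))).trace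
        ∂(wilsonMeasure (d := d) (L := L) (fundamentalRep (Fin N)) β)) -
      1 / (N : ℂ) * ((∫ U, (fundamentalRep (Fin N) (wordHolonomy U x (plaqWord μ ν₀ true))).trace *
          (fundamentalRep (Fin N) (wordHolonomy U x q)).trace ∂(wilsonMeasure (d := d) (L := L) (fundamentalRep (Fin N)) β)) -
        ∫ U, (fundamentalRep (Fin N) (wordHolonomy U x (plaqWord μ ν₀ true))).trace *
          (fundamentalRep (Fin N) (wordHolonomy U x q.reverse)).trace
            ∂(wilsonMeasure (d := d) (L := L) (fundamentalRep (Fin N)) β))‖ ≤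
      16 * ((d : ℝ) - 1) * (N : ℝ) ^ 2 * |β| / ((N : ℝ) ^ 2 - 1) := by
  have hNpos : (0 : ℝ) < N := by
    have : (2 : ℝ) ≤ N := by exact_mod_cast hN
    linarith
  have hN21 : (0 : ℝ) < (N : ℝ) ^ 2 - 1 := by
    have : (2 : ℝ) ≤ N := by exact_mod_cast hN
    nlinarith
  have hqx' : Word.endpoint x q.reverse = x := by
    have h := Word.endpoint_reverse x q
    rwa [hqx] at h
  have h1 := norm_integral_trace_plaqWord_append_suN_le (d := d) (L := L) hN hL β x hμν₀ hq hqx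
  have h2 := norm_integral_trace_plaqWord_append_suN_le (d := d) (L := L) hN hL β x hμν₀ hq' hqx'
  have h3 := norm_integral_trace_mul_trace_suN_le (d := d) (L := L) hN hL β x hμν₀ hq
  have h4 := norm_integral_trace_mul_trace_suN_le (d := d) (L := L) hN hL β x hμν₀ hq'
  have hNinv : ‖(1 / (N : ℂ))‖ = 1 / N := by
    rw [norm_div, norm_one, Complex.norm_natCast]
  refine (norm_sub_le _ _).trans ?_
  rw [norm_mul, hNinv]
  have h12 := (norm_sub_le _ _).trans (add_le_add h1 h2)
  have h34 := (norm_sub_le _ _).trans (add_le_add h3 h4)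
  have h34' : 1 / (N : ℝ) * ‖(∫ U, (fundamentalRep (Fin N) (wordHolonomy U x (plaqWord μ ν₀ true))).trace *
      (fundamentalRep (Fin N) (wordHolonomy U x q)).trace ∂(wilsonMeasure (d := d) (L := L) (fundamentalRep (Fin N)) β)) -
      ∫ U, (fundamentalRep (Fin N) (wordHolonomy U x (plaqWord μ ν₀ true))).trace *
        (fundamentalRep (Fin N) (wordHolonomy U x q.reverse)).trace ∂(wilsonMeasure (d := d) (L := L) (fundamentalRep (Fin N)) β)‖ ≤
      1 / (N : ℝ) * (4 * ((d : ℝ) - 1) * (N : ℝ) ^ 3 * |β| / ((N : ℝ) ^ 2 - 1) +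
        4 * ((d : ℝ) - 1) * (N : ℝ) ^ 3 * |β| / ((N : ℝ) ^ 2 - 1)) :=
    mul_le_mul_of_nonneg_left h34 (by positivity)
  refine (add_le_add h12 h34').trans (le_of_eq ?_)
  field_simp
  ring

/-- ★★★ **THE `SU(N)` PLAQUETTE AT STRONG COUPLING THROUGH SECOND ORDER** (`N ≥ 3`).  For `d ≥ 2`, every torus side `L ≥ 2`
and EVERY real (tree) coupling `β` (`= β_std/N`):
`|⟨ū_P⟩_{β,L} − β/(2N)| ≤ (2(d−1)β²/(N²−1))·(1 + 4N⁴/((N²−1)(N²−4)) + 4(2d−3)N²/(N²−1))`.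
Two loop-equation steps closed by `|tr| ≤ N`; uniform in the volume. [folklore] -/
theorem abs_wilsonExpectation_meanPlaquette_sub_suN_le (hN : 3 ≤ N) (hL : (1 : ZMod L) ≠ 0) (hd : 2 ≤ d) (β : ℝ) :
    |wilsonExpectation (fundamentalRep (Fin N)) β
        (meanPlaquette (d := d) (L := L) (G := Matrix.specialUnitaryGroup (Fin N) ℂ) (fundamentalRep (Fin N))) -
        β / (2 * N)| ≤
      2 * ((d : ℝ) - 1) * β ^ 2 / ((N : ℝ) ^ 2 - 1) *
        (1 + 4 * (N : ℝ) ^ 4 / (((N : ℝ) ^ 2 - 1) * ((N : ℝ) ^ 2 - 4)) + 4 * (2 * (d : ℝ) - 3) * (N : ℝ) ^ 2 / ((N : ℝ) ^ 2 - 1)) := by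
  obtain ⟨μ, ν₀, hμν₀⟩ : ∃ μ ν₀ : Fin d, μ ≠ ν₀ := ⟨⟨0, by omega⟩, ⟨1, by omega⟩, by simp [Fin.ext_iff]⟩
  have hN2 : 2 ≤ N := by omega
  have hN0 : N ≠ 0 := by omega
  have hN3 : (3 : ℝ) ≤ N := by exact_mod_cast hN
  have hNpos : (0 : ℝ) < N := by linarith
  have hN21 : (0 : ℝ) < (N : ℝ) ^ 2 - 1 := by nlinarith
  have hK : (0 : ℝ) < ((N : ℝ) ^ 2 - 1) * ((N : ℝ) ^ 2 - 4) := mul_pos hN21 (by nlinarith)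
  set x : Site d L := fun _ => 0 with hx
  haveI : IsProbabilityMeasure (wilsonMeasure (d := d) (L := L) (fundamentalRep (Fin N)) β) :=
    isProbabilityMeasure_wilsonMeasure (d := d) (L := L) _ (fundamentalLatticeRep N).continuous β
  -- Step 1: the plaquette loop equation (`s = 1`), restated on the nose
  have hleq := Equipartition.loopEquation_plaqWord (d := d) (L := L) (fundamentalLatticeRep N) hL β x hμν₀ true 1
    fun i j => sdPair_specialUnitaryGroup N β x μ x _ _ (trace_unitDir_one i j)
  simp only [integral_plaqTerm_latticeRep (fundamentalLatticeRep N)] at hleq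
  simp only [fundamentalLatticeRep_N, fundamentalLatticeRep_ρ] at hleq
  have hleq' : ((N : ℂ) - 1 / N) * (∫ U, (fundamentalRep (Fin N) (wordHolonomy U x (plaqWord μ ν₀ true))).trace
      ∂(wilsonMeasure (d := d) (L := L) (fundamentalRep (Fin N)) β)) +
      (β / 2 : ℂ) * ∑ ν ∈ Finset.univ.erase μ, ∑ ε : Bool,
        ((∫ U, (fundamentalRep (Fin N) (wordHolonomy U x (plaqWord μ ν₀ true ++ plaqWord μ ν ε))).trace
            ∂(wilsonMeasure (d := d) (L := L) (fundamentalRep (Fin N)) β)) -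
          (∫ U, (fundamentalRep (Fin N) (wordHolonomy U x (plaqWord μ ν₀ true ++ (plaqWord μ ν ε).reverse))).trace
            ∂(wilsonMeasure (d := d) (L := L) (fundamentalRep (Fin N)) β)) -
          1 / (N : ℂ) * ((∫ U, (fundamentalRep (Fin N) (wordHolonomy U x (plaqWord μ ν₀ true))).trace *
              (fundamentalRep (Fin N) (wordHolonomy U x (plaqWord μ ν ε))).trace
                ∂(wilsonMeasure (d := d) (L := L) (fundamentalRep (Fin N)) β)) -
            ∫ U, (fundamentalRep (Fin N) (wordHolonomy U x (plaqWord μ ν₀ true))).trace *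
              (fundamentalRep (Fin N) (wordHolonomy U x (plaqWord μ ν ε).reverse)).trace
                ∂(wilsonMeasure (d := d) (L := L) (fundamentalRep (Fin N)) β))) = 0 := hleq
  -- the trivial deformation
  have htriv : ∫ U, (fundamentalRep (Fin N)
      (wordHolonomy U x (plaqWord μ ν₀ true ++ (plaqWord μ ν₀ true).reverse))).trace
        ∂(wilsonMeasure (d := d) (L := L) (fundamentalRep (Fin N)) β) = (N : ℂ) := by
    have : ∀ U : GaugeConfig d L (Matrix.specialUnitaryGroup (Fin N) ℂ),
        (fundamentalRep (Fin N) (wordHolonomy U x (plaqWord μ ν₀ true ++ (plaqWord μ ν₀ true).reverse))).trace = (N : ℂ) :=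
      fun U => by rw [wordHolonomy_append_reverse, map_one, Matrix.trace_one, Fintype.card_fin]
    simp_rw [this]
    rw [integral_const, probReal_univ, one_smul]
  -- Step 2: the pieces
  have hb₀ := norm_integral_trace_double_suN_le (d := d) (L := L) hN hL β x hμν₀
  have ha := norm_integral_trace_sq_suN_le (d := d) (L := L) hN hL β x hμν₀
  have hc := norm_integral_trace_mul_trace_reverse_sub_one_suN_le (d := d) (L := L) (by omega : 1 ≤ N) hL β x hμν₀
  have hν₀A : ν₀ ∈ Finset.univ.erase μ := Finset.mem_erase.2 ⟨fun h => hμν₀ h.symm, Finset.mem_univ _⟩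
  have hNinv : ‖(1 / (N : ℂ))‖ = 1 / N := by rw [norm_div, norm_one, Complex.norm_natCast]
  have hmain := norm_sub_le_of_loopEquation (d := d) hν₀A
    (fun ν ε => (∫ U, (fundamentalRep (Fin N) (wordHolonomy U x (plaqWord μ ν₀ true ++ plaqWord μ ν ε))).trace
        ∂(wilsonMeasure (d := d) (L := L) (fundamentalRep (Fin N)) β)) -
      (∫ U, (fundamentalRep (Fin N) (wordHolonomy U x (plaqWord μ ν₀ true ++ (plaqWord μ ν ε).reverse))).trace
        ∂(wilsonMeasure (d := d) (L := L) (fundamentalRep (Fin N)) β)) -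
      1 / (N : ℂ) * ((∫ U, (fundamentalRep (Fin N) (wordHolonomy U x (plaqWord μ ν₀ true))).trace *
          (fundamentalRep (Fin N) (wordHolonomy U x (plaqWord μ ν ε))).trace
            ∂(wilsonMeasure (d := d) (L := L) (fundamentalRep (Fin N)) β)) -
        ∫ U, (fundamentalRep (Fin N) (wordHolonomy U x (plaqWord μ ν₀ true))).trace *
          (fundamentalRep (Fin N) (wordHolonomy U x (plaqWord μ ν ε).reverse)).trace
            ∂(wilsonMeasure (d := d) (L := L) (fundamentalRep (Fin N)) β)))
    (b := (∫ U, (fundamentalRep (Fin N) (wordHolonomy U x (plaqWord μ ν₀ true ++ plaqWord μ ν₀ true))).trace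
        ∂(wilsonMeasure (d := d) (L := L) (fundamentalRep (Fin N)) β)) -
      1 / (N : ℂ) * (∫ U, (fundamentalRep (Fin N) (wordHolonomy U x (plaqWord μ ν₀ true))).trace *
        (fundamentalRep (Fin N) (wordHolonomy U x (plaqWord μ ν₀ true))).trace
          ∂(wilsonMeasure (d := d) (L := L) (fundamentalRep (Fin N)) β)) +
      1 / (N : ℂ) * ((∫ U, (fundamentalRep (Fin N) (wordHolonomy U x (plaqWord μ ν₀ true))).trace *
        (fundamentalRep (Fin N) (wordHolonomy U x (plaqWord μ ν₀ true).reverse)).trace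
          ∂(wilsonMeasure (d := d) (L := L) (fundamentalRep (Fin N)) β)) - 1))
    (B := 16 * ((d : ℝ) - 1) * (N : ℝ) ^ 2 * |β| / ((N : ℝ) ^ 2 - 1))
    (Bb := 8 * ((d : ℝ) - 1) * |β| * ((N : ℝ) ^ 4 / (((N : ℝ) ^ 2 - 1) * ((N : ℝ) ^ 2 - 4))) +
      1 / N * (8 * ((d : ℝ) - 1) * |β| * ((N : ℝ) ^ 5 / (((N : ℝ) ^ 2 - 1) * ((N : ℝ) ^ 2 - 4)))) +
      1 / N * (4 * ((d : ℝ) - 1) * N * |β|))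
    hleq' (by simp only [htriv]; ring)
    (by
      refine (norm_add_le _ _).trans (add_le_add ((norm_sub_le _ _).trans (add_le_add hb₀ ?_)) ?_)
      · rw [norm_mul, hNinv]; exact mul_le_mul_of_nonneg_left ha (by positivity)
      · rw [norm_mul, hNinv]; exact mul_le_mul_of_nonneg_left hc (by positivity))
    (fun ν hν => by
      obtain ⟨hνν₀, hν'⟩ := Finset.mem_erase.1 hν
      have hμν : μ ≠ ν := fun h => (Finset.mem_erase.1 hν').1 h.symm
      exact norm_plaqTermIntegral_suN_le (d := d) (L := L) hN2 hL β x hμν₀ (avoids_plaqWord_true hL x hμν₀ hνν₀)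
        (avoids_plaqWord_true_reverse hL x hμν₀ hνν₀) (endpoint_plaqWord x μ ν true))
    (fun ν hν => by
      have hμν : μ ≠ ν := fun h => (Finset.mem_erase.1 hν).1 h.symm
      exact norm_plaqTermIntegral_suN_le (d := d) (L := L) hN2 hL β x hμν₀ (avoids_plaqWord_false hL x hμν₀ hμν)
        (avoids_plaqWord_false_reverse hL x hμν₀ hμν) (endpoint_plaqWord x μ ν false))
  rw [card_univ_erase_real] at hmain
  -- Step 3: real parts
  have hre := Equipartition.integral_re_trace_plaqWord (d := d) (L := L) (fundamentalLatticeRep N) β x hμν₀ true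
    (by rw [fundamentalLatticeRep_N]; exact hN0)
  have hre0 := Equipartition.re_integral_eq (fundamentalLatticeRep N) β
    (continuous_trace_wordHolonomy (fundamentalLatticeRep N) x (plaqWord μ ν₀ true))
  simp only [fundamentalLatticeRep_N, fundamentalLatticeRep_ρ] at hre hre0
  rw [← hre0] at hre
  have hEP : (∫ U, (fundamentalRep (Fin N) (wordHolonomy U x (plaqWord μ ν₀ true))).trace
      ∂(wilsonMeasure (d := d) (L := L) (fundamentalRep (Fin N)) β)).re =
      N * wilsonExpectation (fundamentalRep (Fin N)) β
        (meanPlaquette (d := d) (L := L) (G := Matrix.specialUnitaryGroup (Fin N) ℂ) (fundamentalRep (Fin N))) := hre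
  have hreal : (((N : ℂ) - 1 / N) * (∫ U, (fundamentalRep (Fin N) (wordHolonomy U x (plaqWord μ ν₀ true))).trace
      ∂(wilsonMeasure (d := d) (L := L) (fundamentalRep (Fin N)) β)) - (β / 2 : ℂ) * ((N : ℂ) - 1 / N)).re =
      ((N : ℝ) ^ 2 - 1) * (wilsonExpectation (fundamentalRep (Fin N)) β
        (meanPlaquette (d := d) (L := L) (G := Matrix.specialUnitaryGroup (Fin N) ℂ) (fundamentalRep (Fin N))) -
          β / (2 * N)) := by
    have hcC : ((N : ℂ) - 1 / N) = ((((N : ℝ) ^ 2 - 1) / N : ℝ) : ℂ) := by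
      have hN0' : (N : ℂ) ≠ 0 := by exact_mod_cast hNpos.ne'
      push_cast; field_simp
    rw [hcC, show (β / 2 : ℂ) = ((β / 2 : ℝ) : ℂ) by push_cast; ring]
    simp only [Complex.sub_re, Complex.mul_re, Complex.ofReal_re, Complex.ofReal_im, mul_zero, sub_zero, zero_mul, hEP]
    field_simp
  have hkey := (Complex.abs_re_le_norm _).trans hmain
  rw [hreal, abs_mul, abs_of_pos hN21] at hkey
  rw [← sq_abs β]
  refine ((le_div_iff₀' hN21).2 hkey).trans (le_of_eq ?_)
  field_simp
  ring

/-- ★★★ **The cell's form, second order** (`SU(N)`, `N ≥ 3`, `D ≥ 2`, every `L ≥ 2`, every real `β_std`):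
`|plaquetteExpectation N D L β_std − β_std/(2N²)| ≤ (2(D−1)β_std²/(N²(N²−1)))·(1 + 4N⁴/((N²−1)(N²−4)) + 4(2D−3)N²/(N²−1))`.
[folklore] -/
theorem abs_plaquetteExpectation_sub_le {N D L : ℕ} [NeZero L] (hN : 3 ≤ N) (hL : 2 ≤ L) (hD : 2 ≤ D) (β : ℝ) :
    |plaquetteExpectation N D L β - β / (2 * (N : ℝ) ^ 2)| ≤
      2 * ((D : ℝ) - 1) * β ^ 2 / ((N : ℝ) ^ 2 * ((N : ℝ) ^ 2 - 1)) *
        (1 + 4 * (N : ℝ) ^ 4 / (((N : ℝ) ^ 2 - 1) * ((N : ℝ) ^ 2 - 4)) + 4 * (2 * (D : ℝ) - 3) * (N : ℝ) ^ 2 / ((N : ℝ) ^ 2 - 1)) := by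
  have hN3 : (3 : ℝ) ≤ N := by exact_mod_cast hN
  have hNpos : (0 : ℝ) < N := by linarith
  have h := abs_wilsonExpectation_meanPlaquette_sub_suN_le (d := D) (L := L) hN (zmod_one_ne_zero hL) hD (β / N)
  unfold plaquetteExpectation
  have e1 : β / N / (2 * N) = β / (2 * (N : ℝ) ^ 2) := by field_simp
  rw [e1] at h
  refine h.trans (le_of_eq ?_)
  field_simp

/-- `T4` (`SU(3)`, `D = 4`): `|plaquetteExpectation 3 4 L β_std − β_std/18| ≤ 79·β_std²/30` for every `L ≥ 2` and every real
`β_std`. [folklore] -/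
theorem abs_plaquetteExpectation_three_four_sub_le {L : ℕ} [NeZero L] (hL : 2 ≤ L) (β : ℝ) :
    |plaquetteExpectation 3 4 L β - β / 18| ≤ 79 * β ^ 2 / 30 := by
  have h := abs_plaquetteExpectation_sub_le (N := 3) (D := 4) (L := L) le_rfl hL (by norm_num) β
  norm_num at h
  convert h using 2; ring

/-- `T3` (`SU(3)`, `D = 3`): `|plaquetteExpectation 3 3 L β_std − β_std/18| ≤ 113·β_std²/90`. [folklore] -/
theorem abs_plaquetteExpectation_three_three_sub_le {L : ℕ} [NeZero L] (hL : 2 ≤ L) (β : ℝ) :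
    |plaquetteExpectation 3 3 L β - β / 18| ≤ 113 * β ^ 2 / 90 := by
  have h := abs_plaquetteExpectation_sub_le (N := 3) (D := 3) (L := L) le_rfl hL (by norm_num) β
  norm_num at h
  convert h using 2; ring

end StrongCoupling

end Summit.QuantumFields.GaugeBoot

end
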